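import Summits.Ventures.YMGap.Thresholds.StarMassGapSUN
import Summits.Ventures.YMGap.Thresholds.StarFrontSUN
import Summits.Ventures.YMGap.Thresholds.StarMassiveSUNRows
import Summits.QuantumFields.BalabanUV.InfraRed.StrongCouplingPoincareDoorSUN
import HarnessLib

/-!
# Venture YMGap — `SU(3)`, `d = 4`: the star door fed by the CERTIFIED Poincaré × variance one-link modulus
# `K = √(c·v) = 7/5` at radius `11/30` ⇒ every SC-a star row at every Wilson `|β_W| ≤ 11/20`

HONEST FRAMING: venture file of the cell `pub-ymgap` (QuantumFields programme), seat engine-2 (g4).  Strong-coupling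
LATTICE statements only, for `SU(3)` lattice Yang–Mills on `ℤ⁴` / `(ℤ/L)⁴` with the Wilson plaquette weight at tree
coupling `β_W/3` (Wilson `β_W = 6/g²`, 't Hooft `β_W/9`).  Nothing about the continuum, weak coupling, or the Clay
problem.  Kernel ARITHMETIC over tree theorems, nothing else; the two displayed hypotheses are finite-dimensional
inequalities about ONE tilted Haar law on `SU(3)` (hypothesis schemas of the `pub-balaban` leaves (38)/(40), NOTHING
asserted about them here) which are CERTIFIED COMPUTATIONS, not proofs — so every row below is «K × C⁻», never K (cell rule R137).

WHAT THIS LEAF DOES.  ds-1's generic-`N` star door (`StarSUN.*_of_oneLinkKRModulus`, `StarSUNLimit.star_massGapAt_of_oneLinkKRModulus`,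
`StarSUNFront.star_strongCouplingFront_of_oneLinkKRModulus`, ds-3's `StarSUNMassive.*_of_oneLinkKRModulus`) takes ANY one-link
modulus `OneLinkKRModulus N R K` on the tilt ball `R ≥ 6|β|/N` and opens iff `4K|β|/N ≤ 9/25`.  The cell's `SU(3)` rows so far
fed it with the Bakry–Émery modulus (`|β_W| ≤ 81/308`, hypothesis-free) or with the VARIANCE-ONLY modulus
`√(v/(3(1/2 − R)))` (`|β_W| ≤ 21/50` given `OneLinkVarianceBound 3 (11/30) (49/20)`), i.e. with Bakry–Émery for the Poincaré
factor of the Cauchy–Schwarz step.  Here BOTH factors are certified: `pub-balaban`'s leaf-(40) modulus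
`oneLinkKRModulus_of_poincare_of_varianceBound : OneLinkPoincareSUN N R c → OneLinkVarianceBound N R v → OneLinkKRModulus N R √(cv)`
at `(R, c, v) = (11/30, 4/5, 49/20)` gives `K = √((4/5)(49/20)) = 7/5` EXACTLY, and then

* the door `4·(7/5)·|β_W|/9 ≤ 9/25` holds iff `|β_W| ≤ 81/140 = 0.578…`, while the radius condition `6|β_W|/9 ≤ 11/30` holds
  iff `|β_W| ≤ 11/20` — the row is capped by the certified RADIUS, not by the door (door value at `11/20`: `77/225 ≤ 81/225`);
* ⇒ at every Wilson `|β_W| ≤ 11/20 = 0.55`: DLR uniqueness on `ℤ⁴`, unique thermodynamic limit, `MassGapAt 4 3 (β_W/9)`, `DLRMassGapAt`,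
  the strong-coupling phase predicate and front, every DLR / limit state massive with exponentially decaying plaquette–plaquette
  correlation function, and the torus covariance bound uniformly in the side `L ≥ 3`.

THE HYPOTHESES AND THEIR CERTIFICATES (displayed, never hidden).
* `OneLinkPoincareSUN 3 (11/30) (4/5)`: every Frobenius-`M`-Lipschitz observable has variance `≤ (4/5)M²` under
  `ν_B ∝ exp(3 Re tr(gB)) Haar_{SU(3)}` for all `‖B‖_op ≤ 11/30` (spectral gap `≥ 5/4`).  It is implied (monotonicity of the schema,
  `poincare_elevenThirtieths_of_threeFifths`) by `OneLinkPoincareSUN 3 (3/5) (4/5)` — certified by the cell `pub-ymgap` with TWO FULL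
  independent ball-arithmetic engines (σ2-A kit j165229, σ2-B j165250–253: 3 447 cells each, 0 unresolved, min Ritz value 1.82008;
  certificate `SU3-RADIUS-certificate-g3.json`) — and (`poincare_fourFifths_of_sharp`) by `pub-balaban`'s two-engine instance
  `OneLinkPoincareSUN 3 (11/30) (53/100)` (certificate «sigma2 g17»); using `4/5` instead of `53/100` loses nothing (radius-capped row).
* `OneLinkVarianceBound 3 (11/30) (49/20)`: `Var_{ν_B}(3 Re tr(gΔ)) ≤ (49/20)‖Δ‖_F²` on the same ball — certified by `pub-balaban`
  (σ1-iv engines 3 + 4, certificate «sigma1-iv g17», sup ≤ 2.4499964) and replayed count-identically under the `ymgap` tag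
  (kit j162750–2); the displayed hypothesis of the tree's `SlabAreaLawVariance` / `StarSUNRows` conditional rows.
Class of every row below (cell notation, PLAN R137): «K × C⁻(H1: two full engines on ONE partition, independent arithmetic) × C-iv(H2)»,
summarised «K × C⁻» (→ «K × C-iv» once an independent-method leg, Engine C EC7, covers the radius-`3/5` Poincaré slab); never K.

COMPARISON (same predicates, each in its class): hypothesis-free `|β_W| ≤ 81/308 = 0.2629…` (`StarSUNLimit.su3_massGapAt_le`, K);
`|β_W| ≤ 21/50 = 0.42` given the variance certificate alone (`su3_massGapAt_le_of_varianceBound`, K × C-iv); printed Shen–Zhu–Zhu /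
`pub-balaban` single-site window `β_W < 3/16`; `pub-balaban`'s best conditional SC-a instance `β_W = 9/20` (leaf (41), DLR door).  This
file: `11/20` (`×55/42` over the cell row, `×44/15` over print).  REMARK ROW: the radius-`3/5` pair ALONE (the hypotheses of the `9/10`
area-law row) gives `K = √(68/25) ≤ 33/20` and the rows at `|β_W| ≤ 27/55 = 0.4909…` (door-capped; displayed once, for `MassGapAt`).
NEXT RUNG (priced, NOT claimed): `β_W = 3/5` needs a NEW certificate pair at radius `2/5` with `c·v ≤ 1.82` (≈ 20 % margins each side).
-/

noncomputable section

open MeasureTheory ProbabilityTheory Function Finset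
open Literature.Probability.LatticeModels
open Literature.MathematicalPhysics.QuantumLattice (fundamentalRep fundamentalLatticeRep ymSpecification
  ymGibbsMeasures infiniteVolumeLimitPoints plaquetteCorrFn HasUniqueInfiniteVolumeLimit LGConfig)
open Literature.MathematicalPhysics.QuantumFieldTheory
open Literature.MathematicalPhysics.QuantumFieldTheory.Balaban1983to89
open Literature.MathematicalPhysics.QuantumFieldTheory.Balaban1983to89.StrongCouplingTorusWindow
open Literature.MathematicalPhysics.QuantumFieldTheory.Balaban1983to89.StrongCouplingDobrushinWindow
  (OneLinkKRModulus DLRMassGapAt)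
open Summit.QuantumFields.BalabanUV.InfraRed.StrongCouplingVarianceDoorSUN (OneLinkVarianceBound)
open Summit.QuantumFields.BalabanUV.InfraRed.StrongCouplingPoincareDoorSUN
  (OneLinkPoincareSUN oneLinkKRModulus_of_poincare_of_varianceBound)
open Literature.Barriers.QuantumFields (IsMassiveState)
open Summit.Ventures.YMGap.DSWindow
open Summit.Ventures.YMGap.StarWindowGauge (gaugeR)

namespace Summit.Ventures.YMGap.StarSU3Certified

/-! ### 1. The certified modulus `K = 7/5` at radius `11/30` -/

/-- `√((4/5)·(49/20)) = 7/5`. -/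
theorem sqrt_fourFifths_mul_fortyNineTwentieths : Real.sqrt (4 / 5 * (49 / 20)) = 7 / 5 := by
  rw [show (4 : ℝ) / 5 * (49 / 20) = (7 / 5) ^ 2 by norm_num]
  exact Real.sqrt_sq (by norm_num)

/-- **The certified one-link modulus of `SU(3)` at radius `11/30`**: `OneLinkPoincareSUN 3 (11/30) (4/5)` and
`OneLinkVarianceBound 3 (11/30) (49/20)` give `OneLinkKRModulus 3 (11/30) (7/5)` — `pub-balaban`'s leaf-(40) Cauchy–Schwarz
modulus `√(c·v)` with BOTH factors supplied by the displayed (certified) hypotheses, `√((4/5)(49/20)) = 7/5`.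
[cite: Follmer1988, Ch. I Theorem (2.13)] -/
theorem su3_oneLinkKRModulus_sevenFifths (hP : OneLinkPoincareSUN 3 (11 / 30) (4 / 5))
    (hv : OneLinkVarianceBound 3 (11 / 30) (49 / 20)) : OneLinkKRModulus 3 (11 / 30) (7 / 5) := by
  have h := oneLinkKRModulus_of_poincare_of_varianceBound (N := 3) (by norm_num) (by norm_num) hP hv
  rwa [sqrt_fourFifths_mul_fortyNineTwentieths] at h

/-- Monotonicity: the cell's radius-`3/5` Poincaré certificate `OneLinkPoincareSUN 3 (3/5) (4/5)` (two full engines,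
`pub-ymgap` kit j165229 + j165250–253) implies the radius-`11/30` hypothesis used here (`11/30 ≤ 3/5`). [folklore] -/
theorem poincare_elevenThirtieths_of_threeFifths (hP : OneLinkPoincareSUN 3 (3 / 5) (4 / 5)) :
    OneLinkPoincareSUN 3 (11 / 30) (4 / 5) :=
  hP.mono (by norm_num) le_rfl

/-- Monotonicity: `pub-balaban`'s two-engine instance `OneLinkPoincareSUN 3 (11/30) (53/100)` (certificate «sigma2 g17»)
implies the radius-`11/30` hypothesis used here (`53/100 ≤ 4/5`). [folklore] -/
theorem poincare_fourFifths_of_sharp (hP : OneLinkPoincareSUN 3 (11 / 30) (53 / 100)) :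
    OneLinkPoincareSUN 3 (11 / 30) (4 / 5) :=
  hP.mono le_rfl (by norm_num)

/-- The door arithmetic in 't Hooft units: `|β_W| ≤ 11/20` gives the radius condition `6·(|β_W|/9) ≤ 11/30` (equality
at `11/20`) and the star door `4·(7/5)·(|β_W|/9) ≤ 9/25` (value `77/225 ≤ 81/225` at `11/20`). [folklore] -/
theorem door_of_abs_le {βW : ℝ} (h : |βW| ≤ 11 / 20) :
    |βW| / 9 * 6 ≤ 11 / 30 ∧ 4 * (7 / 5 * (|βW| / 9)) ≤ 9 / 25 := by
  constructor <;> linarith [abs_nonneg βW]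

/-- Coupling bookkeeping: `|β_W/9| = |β_W|/9`. -/
theorem abs_div_nine (βW : ℝ) : |βW / 9| = |βW| / 9 := by
  rw [abs_div, abs_of_pos (by norm_num : (0 : ℝ) < 9)]

/-! ### 2. The rows at every Wilson `|β_W| ≤ 11/20` (class «K × C⁻(H1) × C-iv(H2)», R137, on the two displayed certificates) -/

/-- **`SU(3)`, `d = 4`: DLR UNIQUENESS on `ℤ⁴` at every Wilson `|β_W| ≤ 11/20 = 0.55`** (tree coupling `β_W/3`), GIVEN the
two certified one-link inequalities `OneLinkPoincareSUN 3 (11/30) (4/5)` and `OneLinkVarianceBound 3 (11/30) (49/20)`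
(finite-dimensional, displayed, certified by two engines each — NOT proved here): the star door with the modulus `K = 7/5`.
Cell rows in the same predicate: `81/308` (hypothesis-free), `21/50` (variance certificate alone). [folklore] -/
theorem su3_hasUniqueGibbsMeasure_abs_le (hP : OneLinkPoincareSUN 3 (11 / 30) (4 / 5))
    (hv : OneLinkVarianceBound 3 (11 / 30) (49 / 20)) {βW : ℝ} (h : |βW| ≤ 11 / 20) :
    HasUniqueGibbsMeasure (ymSpecification (d := 4) (fundamentalRep (Fin 3)) (βW / 3)) := by
  obtain ⟨hR, hdoor⟩ := door_of_abs_le h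
  refine StarSUN.hasUniqueGibbsMeasure_of_oneLinkKRModulus (N := 3) (by norm_num) (by norm_num) ?_
    (su3_oneLinkKRModulus_sevenFifths hP hv) ?_
  · rw [StarSUNMassive.su3_abs_coupling]; exact hR
  · rw [StarSUNMassive.su3_abs_coupling]; exact hdoor

/-- **`SU(3)`, `d = 4`: UNIQUE THERMODYNAMIC LIMIT at every Wilson `|β_W| ≤ 11/20`** (the full sequence of torus Wilson states
converges to the unique DLR state), GIVEN the two certified one-link inequalities. [folklore] -/
theorem su3_hasUniqueInfiniteVolumeLimit_abs_le (hP : OneLinkPoincareSUN 3 (11 / 30) (4 / 5))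
    (hv : OneLinkVarianceBound 3 (11 / 30) (49 / 20)) {βW : ℝ} (h : |βW| ≤ 11 / 20) :
    HasUniqueInfiniteVolumeLimit (d := 4) (fundamentalRep (Fin 3)) (βW / 3) := by
  obtain ⟨hR, hdoor⟩ := door_of_abs_le h
  refine StarSUN.hasUniqueInfiniteVolumeLimit_of_oneLinkKRModulus (N := 3) (by norm_num) (by norm_num) ?_
    (su3_oneLinkKRModulus_sevenFifths hP hv) ?_
  · rw [StarSUNMassive.su3_abs_coupling]; exact hR
  · rw [StarSUNMassive.su3_abs_coupling]; exact hdoor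

/-- ★ **`SU(3)`, `d = 4`: THE TRACK-(a) CURRENCY `MassGapAt 4 3 (β_W/9)` at every Wilson `|β_W| ≤ 11/20 = 0.55`** (DLR uniqueness +
the Shen–Zhu–Zhu covariance clause for every DLR state), GIVEN `OneLinkPoincareSUN 3 (11/30) (4/5)` and
`OneLinkVarianceBound 3 (11/30) (49/20)` (certified computations, displayed): `StarSUNLimit.star_massGapAt_of_oneLinkKRModulus` with
`K = 7/5`.  Same predicate: `81/308` hypothesis-free, `21/50` on the variance certificate alone, printed window `3/16`. [folklore] -/
theorem su3_massGapAt_abs_le (hP : OneLinkPoincareSUN 3 (11 / 30) (4 / 5))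
    (hv : OneLinkVarianceBound 3 (11 / 30) (49 / 20)) {βW : ℝ} (h : |βW| ≤ 11 / 20) :
    MassGapAt 4 3 (βW / 9) := by
  obtain ⟨hR, hdoor⟩ := door_of_abs_le h
  refine StarSUNLimit.star_massGapAt_of_oneLinkKRModulus (N := 3) (by norm_num) (by norm_num) ?_
    (su3_oneLinkKRModulus_sevenFifths hP hv) ?_
  · rw [abs_div_nine]; exact hR
  · rw [abs_div_nine]; exact hdoor

/-- **`SU(3)`, `d = 4`, SC-a currency: `DLRMassGapAt 4 3 (β_W/9)` at every Wilson `|β_W| ≤ 11/20`**, GIVEN the two certified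
one-link inequalities — the SAME Literature predicate as `pub-balaban`'s hypothesis-free `su3_dlrMassGapAt_lt` (`β_W < 3/16`) and
conditional `su3_dlrMassGapAt_nineTwentieths_of_poincare_of_varianceBound` (`β_W = 9/20`, DLR door). [folklore] -/
theorem su3_dlrMassGapAt_abs_le (hP : OneLinkPoincareSUN 3 (11 / 30) (4 / 5))
    (hv : OneLinkVarianceBound 3 (11 / 30) (49 / 20)) {βW : ℝ} (h : |βW| ≤ 11 / 20) :
    DLRMassGapAt 4 3 (βW / 9) :=
  massGapAt_iff_dlrMassGapAt.1 (su3_massGapAt_abs_le hP hv h)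

/-- **`SU(3)`, `d = 4`: the strong-coupling PHASE predicate** (`HessianSharp.StrongCouplingPhaseAt 4 3 (β_W/3)`: convergence of
the periodic states along the full sequence of sides to a translation-invariant state, every limit equal to it, exponential
decay of its plaquette–plaquette covariances) **at every Wilson `|β_W| ≤ 11/20`**, GIVEN the two certified one-link
inequalities — p2's bridge `strongCouplingPhaseAt_of_massGapAt`. [folklore] -/
theorem su3_strongCouplingPhaseAt_abs_le (hP : OneLinkPoincareSUN 3 (11 / 30) (4 / 5))
    (hv : OneLinkVarianceBound 3 (11 / 30) (49 / 20)) {βW : ℝ} (h : |βW| ≤ 11 / 20) :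
    HessianSharp.StrongCouplingPhaseAt 4 3 (βW / 3) := by
  refine HessianSharp.strongCouplingPhaseAt_of_massGapAt (by norm_num) (by norm_num) ?_
  have e : βW / 3 / ((3 : ℕ) : ℝ) = βW / 9 := by push_cast; ring
  rw [e]
  exact su3_massGapAt_abs_le hP hv h

/-- **`SU(3)`, `d = 4`: the STRONG-COUPLING FRONT of the crossover ledger at every `0 ≤ β_W ≤ 11/20`** (tree units `β_W/3`;
currency SC-b: exponential clustering on all odd tori at every `0 ≤ β ≤ β_W/3` with one rate), GIVEN the two certified one-link
inequalities — `StarSUNFront.star_strongCouplingFront_of_oneLinkKRModulus` with `K = 7/5`.  Same currency: hypothesis-free `81/308`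
(`su3_strongCouplingFront_le_star`), `pub-balaban`'s `4500/20223`, printed `3/16`; `pub-balaban`'s conditional SC-b instance at `11/20`
(`su3_fronts_elevenTwentieths_of_poincare_of_varianceBound`, gauge-fixed door) needs the SHARPER constant `53/100` — this row only `4/5`. [folklore] -/
theorem su3_strongCouplingFront_le (hP : OneLinkPoincareSUN 3 (11 / 30) (4 / 5))
    (hv : OneLinkVarianceBound 3 (11 / 30) (49 / 20)) {βW : ℝ} (h0 : 0 ≤ βW) (h : βW ≤ 11 / 20) :
    CrossoverLedger.StrongCouplingFront (fundamentalLatticeRep 3) (βW / 3) := by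
  refine StarSUNFront.star_strongCouplingFront_of_oneLinkKRModulus (N := 3) (by norm_num) (by positivity)
    (by norm_num) ?_ (su3_oneLinkKRModulus_sevenFifths hP hv) ?_
  · push_cast; linarith
  · push_cast; linarith

/-- **`SU(3)`, `d = 4`: every infinite-volume LIMIT STATE is massive at every Wilson `|β_W| ≤ 11/20`**, GIVEN the two certified
one-link inequalities. [folklore] -/
theorem su3_isMassiveState_abs_le (hP : OneLinkPoincareSUN 3 (11 / 30) (4 / 5))
    (hv : OneLinkVarianceBound 3 (11 / 30) (49 / 20)) {βW : ℝ} (h : |βW| ≤ 11 / 20) :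
    ∀ μ ∈ infiniteVolumeLimitPoints (d := 4) (fundamentalRep (Fin 3)) (βW / 3), IsMassiveState μ := by
  obtain ⟨hR, hdoor⟩ := door_of_abs_le h
  refine StarSUNMassive.isMassiveState_of_oneLinkKRModulus (N := 3) (by norm_num) (by norm_num) ?_
    (su3_oneLinkKRModulus_sevenFifths hP hv) ?_
  · rw [StarSUNMassive.su3_abs_coupling]; exact hR
  · rw [StarSUNMassive.su3_abs_coupling]; exact hdoor

/-- **`SU(3)`, `d = 4`: EVERY DLR STATE on `ℤ⁴` is MASSIVE at every Wilson `|β_W| ≤ 11/20`** (`IsMassiveState μ` for every `μ ∈ ymGibbsMeasures`),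
GIVEN the two certified one-link inequalities — ds-3's `StarSUNMassive.isMassiveState_of_mem_ymGibbsMeasures_of_oneLinkKRModulus`
(uniqueness makes the DLR state the limit state) with `K = 7/5`. [folklore] -/
theorem su3_isMassiveState_dlr_abs_le (hP : OneLinkPoincareSUN 3 (11 / 30) (4 / 5))
    (hv : OneLinkVarianceBound 3 (11 / 30) (49 / 20)) {βW : ℝ} (h : |βW| ≤ 11 / 20) :
    ∀ μ ∈ ymGibbsMeasures (d := 4) (fundamentalRep (Fin 3)) (βW / 3), IsMassiveState μ := by
  obtain ⟨hR, hdoor⟩ := door_of_abs_le h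
  refine StarSUNMassive.isMassiveState_of_mem_ymGibbsMeasures_of_oneLinkKRModulus (N := 3) (by norm_num)
    (by norm_num) ?_ (su3_oneLinkKRModulus_sevenFifths hP hv) ?_
  · rw [StarSUNMassive.su3_abs_coupling]; exact hR
  · rw [StarSUNMassive.su3_abs_coupling]; exact hdoor

/-- **`SU(3)`, `d = 4`: EXPONENTIAL DECAY OF THE PLAQUETTE–PLAQUETTE CORRELATION FUNCTION** of every infinite-volume limit
state at every Wilson `|β_W| ≤ 11/20` (Chatterjee's `f_β`; the operational mass-gap criterion), GIVEN the two certified one-link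
inequalities. [folklore] -/
theorem su3_hasExponentialDecay_plaquetteCorrFn_abs_le (hP : OneLinkPoincareSUN 3 (11 / 30) (4 / 5))
    (hv : OneLinkVarianceBound 3 (11 / 30) (49 / 20)) {βW : ℝ} (h : |βW| ≤ 11 / 20) :
    ∀ μ ∈ infiniteVolumeLimitPoints (d := 4) (fundamentalRep (Fin 3)) (βW / 3),
      HasExponentialDecay (plaquetteCorrFn (fundamentalRep (Fin 3)) μ) := by
  obtain ⟨hR, hdoor⟩ := door_of_abs_le h
  refine StarSUNMassive.hasExponentialDecay_plaquetteCorrFn_of_oneLinkKRModulus (N := 3) (by norm_num)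
    (by norm_num) ?_ (su3_oneLinkKRModulus_sevenFifths hP hv) ?_
  · rw [StarSUNMassive.su3_abs_coupling]; exact hR
  · rw [StarSUNMassive.su3_abs_coupling]; exact hdoor

/-- **`SU(3)`, `d = 4`: exponential decay of the plaquette–plaquette correlation function of EVERY DLR STATE** at every Wilson
`|β_W| ≤ 11/20`, GIVEN the two certified one-link inequalities (the DLR state is unique, hence the limit state). [folklore] -/
theorem su3_hasExponentialDecay_plaquetteCorrFn_dlr_abs_le (hP : OneLinkPoincareSUN 3 (11 / 30) (4 / 5))
    (hv : OneLinkVarianceBound 3 (11 / 30) (49 / 20)) {βW : ℝ} (h : |βW| ≤ 11 / 20) :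
    ∀ μ ∈ ymGibbsMeasures (d := 4) (fundamentalRep (Fin 3)) (βW / 3),
      HasExponentialDecay (plaquetteCorrFn (fundamentalRep (Fin 3)) μ) := by
  intro μ hμ
  haveI : SecondCountableTopology (Matrix (Fin 3) (Fin 3) ℂ) :=
    inferInstanceAs (SecondCountableTopology (Fin 3 → Fin 3 → ℂ))
  haveI : SecondCountableTopology (Matrix.specialUnitaryGroup (Fin 3) ℂ) :=
    Topology.IsEmbedding.subtypeVal.secondCountableTopology
  have hρc := Literature.MathematicalPhysics.QuantumLattice.continuous_fundamentalRep (Fin 3)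
  obtain ⟨ν, hν⟩ := Literature.MathematicalPhysics.QuantumLattice.infiniteVolumeLimitPoints_nonempty_holds
    (d := 4) (fundamentalRep (Fin 3)) hρc (βW / 3)
  have hνG : ν ∈ ymGibbsMeasures (d := 4) (fundamentalRep (Fin 3)) (βW / 3) :=
    Literature.MathematicalPhysics.QuantumLattice.mem_ymGibbsMeasures_of_mem_infiniteVolumeLimitPoints_holds
      (d := 4) (fundamentalRep (Fin 3)) hρc hν
  have hμν : μ = ν := (su3_hasUniqueGibbsMeasure_abs_le hP hv h).1 hμ hνG
  rw [hμν]
  exact su3_hasExponentialDecay_plaquetteCorrFn_abs_le hP hv h ν hν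

/-- **`SU(3)`, `d = 4`: the TORUS covariance bound, uniformly in the side `L ≥ 3`**, at every Wilson `|β_W| ≤ 11/20`, GIVEN the two certified
one-link inequalities (`|cov(f,g)| ≤ 4(2√3)² exp(−(1−ρ)² L₀/(2(16ρ+1))) (Σδf)(Σδg)`, `ρ = R_G(4·(7/5)·|β_W|/9) < 1`; ds-1's
`StarSUN.abs_covariance_le_of_oneLinkKRModulus` with `K = 7/5`). [folklore] -/
theorem su3_abs_covariance_le {L : ℕ} [NeZero L] (hL : 3 ≤ L) (hP : OneLinkPoincareSUN 3 (11 / 30) (4 / 5))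
    (hv : OneLinkVarianceBound 3 (11 / 30) (49 / 20)) {βW : ℝ} (h : |βW| ≤ 11 / 20)
    {f g : GaugeConfig 4 L (Matrix.specialUnitaryGroup (Fin 3) ℂ) → ℝ} {Δf Δg : Finset (Edge 4 L)}
    {δf δg : Edge 4 L → ℝ} (hf : LinkObs suFrobDist f Δf δf) (hg : LinkObs suFrobDist g Δg δg)
    (L₀ : ℕ) (hL₀ : ∀ x ∈ Δf, ∀ z ∈ Δg, ∀ a ∈ linkEnds x, ∀ w ∈ linkEnds z, L₀ ≤ torusNorm (a - w)) :
    |cov[f, g; wilsonMeasure (d := 4) (L := L) (fundamentalRep (Fin 3)) (βW / 3)]| ≤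
      4 * (2 * Real.sqrt (3 : ℕ)) ^ 2 *
        Real.exp (-((1 - gaugeR (4 * (7 / 5 * (|βW / 3| / (3 : ℕ))))) ^ 2 /
          (2 * (16 * gaugeR (4 * (7 / 5 * (|βW / 3| / (3 : ℕ)))) + 1)) * L₀)) *
        (∑ x ∈ Δf, δf x) * ∑ y ∈ Δg, δg y := by
  obtain ⟨hR, hdoor⟩ := door_of_abs_le h
  refine StarSUN.abs_covariance_le_of_oneLinkKRModulus (N := 3) hL (by norm_num) (by norm_num) ?_
    (su3_oneLinkKRModulus_sevenFifths hP hv) ?_ hf hg L₀ hL₀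
  · rw [StarSUNMassive.su3_abs_coupling]; exact hR
  · rw [StarSUNMassive.su3_abs_coupling]; exact hdoor

/-! ### 3. ★ THE ROWS OF RECORD: displayed hypotheses = EXACTLY the two certified statements
`OneLinkPoincareSUN 3 (3/5) (4/5)` (H1: `pub-ymgap`, σ2 engines A + B full, kit j165229 + j165250–253) and
`OneLinkVarianceBound 3 (11/30) (49/20)` (H2: `pub-balaban` g17 σ1-iv engines 3 + 4 + `pub-ymgap` count-identical replay j162750–2) -/

/-- ★ **`SU(3)`, `d = 4`: `MassGapAt 4 3 (β_W/9)` at every Wilson `|β_W| ≤ 11/20 = 0.55` ON THE CELL'S CERTIFICATES** — displayed hypotheses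
exactly H1 `OneLinkPoincareSUN 3 (3/5) (4/5)` (two full engines, `pub-ymgap`) and H2 `OneLinkVarianceBound 3 (11/30) (49/20)` (`pub-balaban` g17
two engines + `pub-ymgap` replay); H1 enters through the radius monotonicity `poincare_elevenThirtieths_of_threeFifths` (proved above).
Class «K × C⁻(H1) × C-iv(H2)» (R137).  Same predicate: `81/308` (K), `21/50` (K × C-iv, H2 alone), printed `3/16`. [folklore] -/
theorem su3_massGapAt_abs_le_of_certificates (hP : OneLinkPoincareSUN 3 (3 / 5) (4 / 5))
    (hv : OneLinkVarianceBound 3 (11 / 30) (49 / 20)) {βW : ℝ} (h : |βW| ≤ 11 / 20) :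
    MassGapAt 4 3 (βW / 9) :=
  su3_massGapAt_abs_le (poincare_elevenThirtieths_of_threeFifths hP) hv h

/-- ★ **`SU(3)`, `d = 4`: DLR UNIQUENESS on `ℤ⁴` at every Wilson `|β_W| ≤ 11/20` on the cell's certificates** H1 `OneLinkPoincareSUN 3 (3/5) (4/5)`,
H2 `OneLinkVarianceBound 3 (11/30) (49/20)`. [folklore] -/
theorem su3_hasUniqueGibbsMeasure_abs_le_of_certificates (hP : OneLinkPoincareSUN 3 (3 / 5) (4 / 5))
    (hv : OneLinkVarianceBound 3 (11 / 30) (49 / 20)) {βW : ℝ} (h : |βW| ≤ 11 / 20) :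
    HasUniqueGibbsMeasure (ymSpecification (d := 4) (fundamentalRep (Fin 3)) (βW / 3)) :=
  su3_hasUniqueGibbsMeasure_abs_le (poincare_elevenThirtieths_of_threeFifths hP) hv h

/-- ★ **`SU(3)`, `d = 4`: UNIQUE THERMODYNAMIC LIMIT at every Wilson `|β_W| ≤ 11/20` on the cell's certificates** H1, H2. [folklore] -/
theorem su3_hasUniqueInfiniteVolumeLimit_abs_le_of_certificates (hP : OneLinkPoincareSUN 3 (3 / 5) (4 / 5))
    (hv : OneLinkVarianceBound 3 (11 / 30) (49 / 20)) {βW : ℝ} (h : |βW| ≤ 11 / 20) :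
    HasUniqueInfiniteVolumeLimit (d := 4) (fundamentalRep (Fin 3)) (βW / 3) :=
  su3_hasUniqueInfiniteVolumeLimit_abs_le (poincare_elevenThirtieths_of_threeFifths hP) hv h

/-- ★ **`SU(3)`, `d = 4`, SC-a currency: `DLRMassGapAt 4 3 (β_W/9)` at every Wilson `|β_W| ≤ 11/20` on the cell's certificates** H1, H2 —
the SAME Literature predicate as `pub-balaban`'s `su3_dlrMassGapAt_lt` (`β_W < 3/16`, hypothesis-free). [folklore] -/
theorem su3_dlrMassGapAt_abs_le_of_certificates (hP : OneLinkPoincareSUN 3 (3 / 5) (4 / 5))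
    (hv : OneLinkVarianceBound 3 (11 / 30) (49 / 20)) {βW : ℝ} (h : |βW| ≤ 11 / 20) :
    DLRMassGapAt 4 3 (βW / 9) :=
  su3_dlrMassGapAt_abs_le (poincare_elevenThirtieths_of_threeFifths hP) hv h

/-- ★ **`SU(3)`, `d = 4`: the strong-coupling PHASE predicate at every Wilson `|β_W| ≤ 11/20` on the cell's certificates** H1, H2.
[folklore] -/
theorem su3_strongCouplingPhaseAt_abs_le_of_certificates (hP : OneLinkPoincareSUN 3 (3 / 5) (4 / 5))
    (hv : OneLinkVarianceBound 3 (11 / 30) (49 / 20)) {βW : ℝ} (h : |βW| ≤ 11 / 20) :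
    HessianSharp.StrongCouplingPhaseAt 4 3 (βW / 3) :=
  su3_strongCouplingPhaseAt_abs_le (poincare_elevenThirtieths_of_threeFifths hP) hv h

/-- ★ **`SU(3)`, `d = 4`: the STRONG-COUPLING FRONT at every `0 ≤ β_W ≤ 11/20` on the cell's certificates** H1, H2 (currency SC-b; same
Literature statement as the hypothesis-free `su3_strongCouplingFront_le_star`, `81/308`, and `pub-balaban`'s `su3_strongCouplingFront_lt`,
`4500/20223`). [folklore] -/
theorem su3_strongCouplingFront_le_of_certificates (hP : OneLinkPoincareSUN 3 (3 / 5) (4 / 5))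
    (hv : OneLinkVarianceBound 3 (11 / 30) (49 / 20)) {βW : ℝ} (h0 : 0 ≤ βW) (h : βW ≤ 11 / 20) :
    CrossoverLedger.StrongCouplingFront (fundamentalLatticeRep 3) (βW / 3) :=
  su3_strongCouplingFront_le (poincare_elevenThirtieths_of_threeFifths hP) hv h0 h

/-- ★ **`SU(3)`, `d = 4`: EVERY DLR STATE on `ℤ⁴` is MASSIVE at every Wilson `|β_W| ≤ 11/20` on the cell's certificates** H1, H2.
[folklore] -/
theorem su3_isMassiveState_dlr_abs_le_of_certificates (hP : OneLinkPoincareSUN 3 (3 / 5) (4 / 5))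
    (hv : OneLinkVarianceBound 3 (11 / 30) (49 / 20)) {βW : ℝ} (h : |βW| ≤ 11 / 20) :
    ∀ μ ∈ ymGibbsMeasures (d := 4) (fundamentalRep (Fin 3)) (βW / 3), IsMassiveState μ :=
  su3_isMassiveState_dlr_abs_le (poincare_elevenThirtieths_of_threeFifths hP) hv h

/-- ★ **`SU(3)`, `d = 4`: every infinite-volume LIMIT STATE is massive at every Wilson `|β_W| ≤ 11/20` on the cell's certificates** H1, H2.
[folklore] -/
theorem su3_isMassiveState_abs_le_of_certificates (hP : OneLinkPoincareSUN 3 (3 / 5) (4 / 5))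
    (hv : OneLinkVarianceBound 3 (11 / 30) (49 / 20)) {βW : ℝ} (h : |βW| ≤ 11 / 20) :
    ∀ μ ∈ infiniteVolumeLimitPoints (d := 4) (fundamentalRep (Fin 3)) (βW / 3), IsMassiveState μ :=
  su3_isMassiveState_abs_le (poincare_elevenThirtieths_of_threeFifths hP) hv h

/-- ★ **`SU(3)`, `d = 4`: EXPONENTIAL DECAY OF THE PLAQUETTE–PLAQUETTE CORRELATION FUNCTION of every DLR state at every Wilson
`|β_W| ≤ 11/20` on the cell's certificates** H1, H2. [folklore] -/
theorem su3_hasExponentialDecay_plaquetteCorrFn_dlr_abs_le_of_certificates (hP : OneLinkPoincareSUN 3 (3 / 5) (4 / 5))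
    (hv : OneLinkVarianceBound 3 (11 / 30) (49 / 20)) {βW : ℝ} (h : |βW| ≤ 11 / 20) :
    ∀ μ ∈ ymGibbsMeasures (d := 4) (fundamentalRep (Fin 3)) (βW / 3),
      HasExponentialDecay (plaquetteCorrFn (fundamentalRep (Fin 3)) μ) :=
  su3_hasExponentialDecay_plaquetteCorrFn_dlr_abs_le (poincare_elevenThirtieths_of_threeFifths hP) hv h

/-- ★ **`SU(3)`, `d = 4`: exponential decay of the plaquette–plaquette correlation function of every infinite-volume limit state at every
Wilson `|β_W| ≤ 11/20` on the cell's certificates** H1, H2. [folklore] -/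
theorem su3_hasExponentialDecay_plaquetteCorrFn_abs_le_of_certificates (hP : OneLinkPoincareSUN 3 (3 / 5) (4 / 5))
    (hv : OneLinkVarianceBound 3 (11 / 30) (49 / 20)) {βW : ℝ} (h : |βW| ≤ 11 / 20) :
    ∀ μ ∈ infiniteVolumeLimitPoints (d := 4) (fundamentalRep (Fin 3)) (βW / 3),
      HasExponentialDecay (plaquetteCorrFn (fundamentalRep (Fin 3)) μ) :=
  su3_hasExponentialDecay_plaquetteCorrFn_abs_le (poincare_elevenThirtieths_of_threeFifths hP) hv h

/-- ★ Endpoint instance on the cell's certificates: **`MassGapAt 4 3 ((11/20)/9)`** — `SU(3)`, Wilson `β_W = 11/20` (`g² = 120/11`).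
[folklore] -/
theorem su3_massGapAt_elevenTwentieths_of_certificates (hP : OneLinkPoincareSUN 3 (3 / 5) (4 / 5))
    (hv : OneLinkVarianceBound 3 (11 / 30) (49 / 20)) : MassGapAt 4 3 ((11 / 20 : ℝ) / 9) :=
  su3_massGapAt_abs_le_of_certificates hP hv (by rw [abs_of_pos (by norm_num : (0 : ℝ) < 11 / 20)])

/-! ### 3b. The same rows on `pub-balaban`'s leaf-(41) pair -/

/-- **The same rows on `pub-balaban`'s leaf-(41) pair** `OneLinkPoincareSUN 3 (11/30) (53/100)`, `OneLinkVarianceBound 3 (11/30) (49/20)`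
(both two-engine certified there): `MassGapAt 4 3 (β_W/9)` at every `|β_W| ≤ 11/20` (the other § 2 rows follow identically through
`poincare_fourFifths_of_sharp`). [folklore] -/
theorem su3_massGapAt_abs_le_of_sharp_pair (hP : OneLinkPoincareSUN 3 (11 / 30) (53 / 100))
    (hv : OneLinkVarianceBound 3 (11 / 30) (49 / 20)) {βW : ℝ} (h : |βW| ≤ 11 / 20) :
    MassGapAt 4 3 (βW / 9) :=
  su3_massGapAt_abs_le (poincare_fourFifths_of_sharp hP) hv h

/-! ### 4. Remark row: the radius-`3/5` pair alone (the hypotheses of the `9/10` area-law row) -/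

/-- `√((4/5)·(17/5)) ≤ 33/20` (`(33/20)² = 1089/400 ≥ 68/25`). -/
theorem sqrt_fourFifths_mul_seventeenFifths_le : Real.sqrt (4 / 5 * (17 / 5)) ≤ 33 / 20 := by
  rw [Real.sqrt_le_left (by norm_num)]
  norm_num

/-- REMARK ROW: the radius-`3/5` pair ALONE — `OneLinkPoincareSUN 3 (3/5) (4/5)` and `OneLinkVarianceBound 3 (3/5) (17/5)`, the displayed
hypotheses of the cell's `9/10` area-law row (`SlabAreaLawSU3Radius`) — gives the modulus `K = √(68/25) ≤ 33/20` on the ball `3/5` and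
hence `MassGapAt 4 3 (β_W/9)` at every `|β_W| ≤ 27/55 = 0.4909…` (door-capped: `4·(33/20)·(27/55)/9 = 9/25`; radius `18/55 ≤ 3/5`).
Weaker than § 2 (`11/20`); recorded once so that the `9/10` pair's SC-a content is on file. [folklore] -/
theorem su3_massGapAt_abs_le_of_nineTenths_pair (hP : OneLinkPoincareSUN 3 (3 / 5) (4 / 5))
    (hv : OneLinkVarianceBound 3 (3 / 5) (17 / 5)) {βW : ℝ} (h : |βW| ≤ 27 / 55) :
    MassGapAt 4 3 (βW / 9) := by
  have hmod := oneLinkKRModulus_of_poincare_of_varianceBound (N := 3) (by norm_num) (by norm_num) hP hv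
  have hmod' : OneLinkKRModulus 3 (3 / 5) (33 / 20) :=
    StarSUN.oneLinkKRModulus_mono_const hmod sqrt_fourFifths_mul_seventeenFifths_le
  have h0 := abs_nonneg βW
  refine StarSUNLimit.star_massGapAt_of_oneLinkKRModulus (N := 3) (by norm_num) (by norm_num) ?_ hmod' ?_
  · rw [abs_div_nine]; linarith
  · rw [abs_div_nine]; linarith

/-! ### 5. Numbers -/

/-- Numbers of this leaf (all by `norm_num`): the modulus `(7/5)² = (4/5)(49/20)`; the door value at `11/20`, `77/225 ≤ 9/25`, and the door's
own reach `81/140` (where `4·(7/5)·β_W/9 = 9/25`) beyond the radius cap `11/20` (`6·(11/20)/9 = 11/30`); the ladder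
`3/16 < 81/308 < 21/50 < 27/55 < 11/20 < 81/140`; the ratios `(11/20)/(21/50) = 55/42`, `(11/20)/(3/16) = 44/15`; the remark row's
door equality `4·(33/20)·(27/55)/9 = 9/25` and radius `18/55 ≤ 3/5`; `pub-balaban`'s sharper constant: `(53/100)(49/20) ≤ (8/7)²`
(modulus `≤ 8/7`, door reach `567/800 = 0.70875`, equally radius-capped at `11/20`); and the Haar floors `3/8 ≤ 4/5`, `3/2 ≤ 49/20`
the hypotheses respect. [folklore] -/
theorem certifiedRows_numbers :
    (7 / 5 : ℝ) ^ 2 = 4 / 5 * (49 / 20) ∧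
      4 * (7 / 5 * ((11 / 20 : ℝ) / 9)) = 77 / 225 ∧ (77 / 225 : ℝ) ≤ 9 / 25 ∧
      4 * (7 / 5 * ((81 / 140 : ℝ) / 9)) = 9 / 25 ∧ (11 / 20 : ℝ) < 81 / 140 ∧
      6 * ((11 / 20 : ℝ) / 9) = 11 / 30 ∧
      (3 / 16 : ℝ) < 81 / 308 ∧ (81 / 308 : ℝ) < 21 / 50 ∧ (21 / 50 : ℝ) < 27 / 55 ∧ (27 / 55 : ℝ) < 11 / 20 ∧
      (11 / 20 : ℝ) / (21 / 50) = 55 / 42 ∧ (11 / 20 : ℝ) / (3 / 16) = 44 / 15 ∧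
      4 * (33 / 20 * ((27 / 55 : ℝ) / 9)) = 9 / 25 ∧ 6 * ((27 / 55 : ℝ) / 9) = 18 / 55 ∧ (18 / 55 : ℝ) ≤ 3 / 5 ∧
      (53 / 100 : ℝ) * (49 / 20) ≤ (8 / 7) ^ 2 ∧ 4 * (8 / 7 * ((567 / 800 : ℝ) / 9)) = 9 / 25 ∧
      (3 / 8 : ℝ) ≤ 4 / 5 ∧ (3 / 2 : ℝ) ≤ 49 / 20 := by
  norm_num

end Summit.Ventures.YMGap.StarSU3Certified

end
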